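import Mathlib
import Summits.ValiantsHypothesis.ValiantsHypothesis.Theorems.ValuativeGCTValuativeFlipRayStabilityPer
import Summits.ValiantsHypothesis.ValiantsHypothesis.Theorems.ValuativeGCTValuativeFlipRayStabilityPlethysm
import Summits.ValiantsHypothesis.ValiantsHypothesis.Theorems.ValuativeGCTValuativeFlipPaddingTransfer
import HarnessLib

/-!
# `ValuativeGCT.ValuativeFlip` (stmt-ValiantsHypothesis-12624): ray stability, V — the permanent side
# UNCONDITIONALLY, and the complete chain of stable values

Wall-breaker k16 (axis "representation-stability transfer between `m` and `m + 1`"), companion of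
`…RayStability` I–IV.  File II derived the per-side ray stability from the eventual padding transfer
taken as a hypothesis `hEPT`; wall-breaker k4's theorem `eventualPaddingTransfer`
(`…PaddingTransfer`, p119869) now discharges it.  Letters as in file I:
`P(j) = mult_{(μ♯(n+j))*} ℂ[Δ_{n+j}(X₀₀^j per_n)]`, `K(j) = K_{n+j}((μ♯(n+j))*)`, `a(j) = a_{μ♯(n+j)}(δ[n+j])`,
`g(j) = g(μ♯(n+j), (n+j)×δ, (n+j)×δ)`.

* `per_rayStable` — **`P(j)` is eventually constant `=: P∞(μ)` and `P(j) ≤ P∞(μ)` for every `j`**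
  (unconditional).
* `per_rayLimit_le_det_rayLimit` — `P_n(μ) ≤ P∞(μ) ≤ K∞(μ)`.
* `det_lt_rayLimit_of_flip`, `det_lt_rayLimit_of_flip_inner` — **a flip `K(j) < P(j)` on the ray of
  `μ` (at any inner size `n' ≤ n`) forces `K(j) < K∞(μ)`**: flips certify pre-stable determinant rays.
* **`rayStability_chain`** — THE COMPLETE STABLE PICTURE OF THE AXIS in one statement: common
  threshold `j₀` and stable values with `P(j) = P∞`, `K(j) = K∞`, `a(j) = a∞`, `g(j) = g∞` for
  `j ≥ j₀`; `P ≤ P∞`, `K ≤ K∞`, `a ≤ a∞` everywhere; and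
  **`P_n(μ) ≤ P∞ ≤ K∞ ≤ a∞ ≤ g∞`, `K_n(μ*) ≤ K∞`**.

[BLMW 2011 §6.4 Problem 6.10; Ikenmeyer–Panova 2017 Thm. 2.1, Prop. 2.8; Manivel 2011; this crux's
`eventualPaddingTransfer` (k4), `det_eventualMonotone` (k16 gen 1), `…RayStability` I–IV (k16)]
-/

set_option linter.dupNamespace false

namespace Summit.ValiantsHypothesis.ValiantsHypothesis.Theorems.ValuativeFlip

open Literature.NumberTheory.DiophantineGeometry
open Literature.Computability.AlgebraicComplexity
open Literature.Computability.Complexity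

noncomputable section

/-- **RAY STABILITY OF THE PADDED PERMANENT (unconditional).**  For `n ≥ 1`, `δ`, `μ ⊢ n·δ` with at
most `n²` parts, `P(j) = mult_{(μ♯(n+j))*} ℂ[Δ_{n+j}(X₀₀^j per_n)]` is eventually CONSTANT `=: P∞(μ)` in
the padding `j`, and `P(j) ≤ P∞(μ)` for every `j` (`per_rayStable_of_eventualPaddingTransfer` fed with
k4's `eventualPaddingTransfer`). [BLMW 2011 §6.4; this crux, k4 + k16] -/
theorem per_rayStable (n δ : ℕ) [NeZero n] (μ : Nat.Partition (n * δ)) (hμ : μ.parts.card ≤ n * n) :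
    ∃ j₀ P : ℕ,
      (∀ j : ℕ, j₀ ≤ j → ∀ [NeZero (n + j)],
        orbitMultiplicity ℂ (paddedPerFormLex ℂ n (n + j)) (n + j) (partitionWeightLex (n + j) (rowLift μ j)) = P) ∧
      (∀ (j : ℕ) [NeZero (n + j)],
        orbitMultiplicity ℂ (paddedPerFormLex ℂ n (n + j)) (n + j) (partitionWeightLex (n + j) (rowLift μ j)) ≤ P) :=
  per_rayStable_of_eventualPaddingTransfer eventualPaddingTransfer n δ μ hμ

/-- **`P_n(μ) ≤ P∞(μ) ≤ K∞(μ)` (unconditional)**: for any eventual values `P∞` of the permanent's ray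
and `K∞` of the determinant's ray. [this crux, k4 + k16] -/
theorem per_rayLimit_le_det_rayLimit (n δ : ℕ) [NeZero n] (μ : Nat.Partition (n * δ))
    (hμ : μ.parts.card ≤ n * n) {P K : ℕ}
    (hP : ∃ j₀ : ℕ, ∀ j : ℕ, j₀ ≤ j → ∀ [NeZero (n + j)],
      orbitMultiplicity ℂ (paddedPerFormLex ℂ n (n + j)) (n + j) (partitionWeightLex (n + j) (rowLift μ j)) = P)
    (hK : ∃ j₀ : ℕ, ∀ j : ℕ, j₀ ≤ j →
      orbitMultiplicity ℂ (detFormLex ℂ (n + j)) (n + j) (partitionWeightLex (n + j) (rowLift μ j)) = K) :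
    orbitMultiplicity ℂ (paddedPerFormLex ℂ n n) n (partitionWeightLex n μ) ≤ P ∧ P ≤ K :=
  per_rayLimit_le_det_rayLimit_of_eventualPaddingTransfer eventualPaddingTransfer n δ μ hμ hP hK

/-- **A flip on the ray certifies a pre-stable determinant ray (unconditional)**: `K(j) < P(j)` forces
`K(j) < K∞(μ)` strictly, for any eventual value `K∞(μ)` of the determinant's ray. [this crux, k4 + k16] -/
theorem det_lt_rayLimit_of_flip (n δ : ℕ) [NeZero n] (μ : Nat.Partition (n * δ))
    (hμ : μ.parts.card ≤ n * n) {K : ℕ}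
    (hK : ∃ j₀ : ℕ, ∀ j : ℕ, j₀ ≤ j →
      orbitMultiplicity ℂ (detFormLex ℂ (n + j)) (n + j) (partitionWeightLex (n + j) (rowLift μ j)) = K)
    (j : ℕ) [NeZero (n + j)]
    (hflip : orbitMultiplicity ℂ (detFormLex ℂ (n + j)) (n + j) (partitionWeightLex (n + j) (rowLift μ j)) <
      orbitMultiplicity ℂ (paddedPerFormLex ℂ n (n + j)) (n + j) (partitionWeightLex (n + j) (rowLift μ j))) :
    orbitMultiplicity ℂ (detFormLex ℂ (n + j)) (n + j) (partitionWeightLex (n + j) (rowLift μ j)) < K :=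
  det_lt_rayLimit_of_flip_of_eventualPaddingTransfer eventualPaddingTransfer n δ μ hμ hK j hflip

/-- **The same at every smaller inner size (unconditional)**: `K(j) < mult_{(μ♯)*} ℂ[Δ_{n+j}(X₀₀^{n+j-n'} per_{n'})]`
with `n' ≤ n` forces `K(j) < K∞(μ)`. [this crux, k4 + k16] -/
theorem det_lt_rayLimit_of_flip_inner (n δ : ℕ) [NeZero n] (μ : Nat.Partition (n * δ))
    (hμ : μ.parts.card ≤ n * n) {K : ℕ}
    (hK : ∃ j₀ : ℕ, ∀ j : ℕ, j₀ ≤ j →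
      orbitMultiplicity ℂ (detFormLex ℂ (n + j)) (n + j) (partitionWeightLex (n + j) (rowLift μ j)) = K)
    (j : ℕ) [NeZero (n + j)] {n' : ℕ} (hn' : n' ≤ n)
    (hflip : orbitMultiplicity ℂ (detFormLex ℂ (n + j)) (n + j) (partitionWeightLex (n + j) (rowLift μ j)) <
      orbitMultiplicity ℂ (paddedPerFormLex ℂ n' (n + j)) (n + j) (partitionWeightLex (n + j) (rowLift μ j))) :
    orbitMultiplicity ℂ (detFormLex ℂ (n + j)) (n + j) (partitionWeightLex (n + j) (rowLift μ j)) < K :=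
  det_lt_rayLimit_of_flip_inner_of_eventualPaddingTransfer eventualPaddingTransfer n δ μ hμ hK j hn' hflip

/-- **THE COMPLETE STABLE PICTURE OF THE `m → m + 1` AXIS.**  For every inner size `n ≥ 1`, degree
`δ` and inner shape `μ ⊢ n·δ` with at most `n²` parts there are a threshold `j₀` and stable values
`P∞, K∞, a∞, g∞` such that along the Kadish–Landsberg ray `j ↦ μ♯(n+j)`:
* for all `j ≥ j₀`: `P(j) = P∞`, `K(j) = K∞`, `a(j) = a∞`, `g(j) = g∞` (the padded permanent's and the
  determinant's orbit-closure multiplicities, the ambient plethysm coefficient and the rectangular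
  Kronecker coefficient are all representation-stable);
* for ALL `j`: `P(j) ≤ P∞`, `K(j) ≤ K∞`, `a(j) ≤ a∞` (each limit is the maximum of its ray);
* `P_n(μ) ≤ P∞ ≤ K∞ ≤ a∞ ≤ g∞` and `K_n(μ*) ≤ K∞`.
So every transfer of the axis converges and the limits are ordered AGAINST a flip: the crux
`ValuativeFlip` lives in the transient `j < j₀(μ)` of the rays of inner shapes (of unbounded length,
`valuativeFlip_iff_longShapes`), where `K(j) < K∞(μ)` strictly (`det_lt_rayLimit_of_flip`).
[BLMW 2011 §6.4; Ikenmeyer–Panova 2017 §2; Manivel 2011; this crux, k4 + k12 + k16] -/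
theorem rayStability_chain (n δ : ℕ) [NeZero n] (μ : Nat.Partition (n * δ)) (hμ : μ.parts.card ≤ n * n) :
    ∃ j₀ P K A G : ℕ,
      (∀ j : ℕ, j₀ ≤ j → ∀ [NeZero (n + j)],
        orbitMultiplicity ℂ (paddedPerFormLex ℂ n (n + j)) (n + j) (partitionWeightLex (n + j) (rowLift μ j)) = P) ∧
      (∀ j : ℕ, j₀ ≤ j →
        orbitMultiplicity ℂ (detFormLex ℂ (n + j)) (n + j) (partitionWeightLex (n + j) (rowLift μ j)) = K) ∧
      (∀ j : ℕ, j₀ ≤ j →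
        plethysmCoeff ℂ (MatIdx (n + j)) (n + j) (partitionWeightLex (n + j) (rowLift μ j)) = A) ∧
      (∀ j : ℕ, j₀ ≤ j →
        kroneckerCoeff ℂ (rowLift μ j) (Nat.Partition.rectangle (n + j) δ) (Nat.Partition.rectangle (n + j) δ) = G) ∧
      (∀ (j : ℕ) [NeZero (n + j)],
        orbitMultiplicity ℂ (paddedPerFormLex ℂ n (n + j)) (n + j) (partitionWeightLex (n + j) (rowLift μ j)) ≤ P) ∧
      (∀ j : ℕ,
        orbitMultiplicity ℂ (detFormLex ℂ (n + j)) (n + j) (partitionWeightLex (n + j) (rowLift μ j)) ≤ K) ∧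
      (∀ j : ℕ, plethysmCoeff ℂ (MatIdx (n + j)) (n + j) (partitionWeightLex (n + j) (rowLift μ j)) ≤ A) ∧
      orbitMultiplicity ℂ (paddedPerFormLex ℂ n n) n (partitionWeightLex n μ) ≤ P ∧
      orbitMultiplicity ℂ (detFormLex ℂ n) n (partitionWeightLex n μ) ≤ K ∧
      P ≤ K ∧ K ≤ A ∧ A ≤ G := by
  obtain ⟨j₁, P, hP, hPle⟩ := per_rayStable n δ μ hμ
  obtain ⟨j₂, K, hK, hKle⟩ := det_rayStable n δ μ hμ
  obtain ⟨j₃, A, hA, hAle⟩ := plethysm_rayStable n δ μ hμ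
  obtain ⟨j₄, G, -, hG, -⟩ := kronecker_rayStable n δ μ
  obtain ⟨hPn, hPK⟩ := per_rayLimit_le_det_rayLimit n δ μ hμ ⟨j₁, hP⟩ ⟨j₂, hK⟩
  obtain ⟨hKA, hAG⟩ := rayLimits_chain n δ μ hμ ⟨j₂, hK⟩ ⟨j₃, hA⟩ ⟨j₄, hG⟩
  refine ⟨max (max j₁ j₂) (max j₃ j₄), P, K, A, G,
    fun j hj _ => hP j ((le_max_left _ _).trans ((le_max_left _ _).trans hj)),
    fun j hj => hK j ((le_max_right _ _).trans ((le_max_left _ _).trans hj)),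
    fun j hj => hA j ((le_max_left _ _).trans ((le_max_right _ _).trans hj)),
    fun j hj => hG j ((le_max_right _ _).trans ((le_max_right _ _).trans hj)),
    fun j _ => hPle j, hKle, hAle, hPn, det_base_le_rayLimit n δ μ hμ ⟨j₂, hK⟩, hPK, hKA, hAG⟩

end

end Summit.ValiantsHypothesis.ValiantsHypothesis.Theorems.ValuativeFlip
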